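import Literature.NumberTheory.ComplexMultiplication.CMOrderWeakEquivalenceLocalIsomorphism
import Literature.NumberTheory.ComplexMultiplication.CMOrderRegularPrimes
import HarnessLib

/-!
# Ideals with PRESCRIBED local components at finitely many primes: for nonzero ideals `I_𝔭` (`𝔭 ∈ F` finite)
# there is `J` with `J_𝔭 = (I_𝔭)_𝔭` for all `𝔭 ∈ F` — the surjectivity of `W(R) → ∏_{𝔭 ⊇ 𝔣} W_𝔭(R)` in
# Marseglia's THEOREM 4.4 (*Local isomorphism classes of fractional ideals of orders in étale algebras*)

Family `hodge`, lane `lit-hodgefound` (Track 2 foundations library; seat p15, row g26-#5), topic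
`Literature/NumberTheory/ComplexMultiplication`, namespaces `Literature.NumberTheory.ComplexMultiplication.NumberRing`
(§§1–2: any one-dimensional noetherian domain `R` with fraction field `K`) and `…EndOrder` (§3: the order
`𝔯 = endOrder ρ` of a number field of any degree).  THEOREMS ONLY: no definition, no instance, no named fact (net
Literature debt `0`).

`CMOrderInvertibleIdealLocalization` (g18-#1) realises prescribed PRINCIPAL local components `x_𝔭R_𝔭` by an
invertible ideal (Stevenhagen Thm. 5.3); here the local components are ARBITRARY nonzero ideals `(I_𝔭)_𝔭`, and the
realising `J` is the (non-invertible in general) ideal `J = Σ_𝔭 e_𝔭I_𝔭` with Chinese-remainder multipliers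
`e_𝔭 ≡ 1 (mod 𝔭^{n_𝔭+1})`, `e_𝔭 ≡ 0 (mod 𝔮^{n_𝔮+1})` (`𝔮 ≠ 𝔭`), where `𝔮^{n_𝔮} ⊆ (I_𝔮)_(𝔮) = I_𝔮R_𝔮 ∩ R`
(`CMOrderPrimaryDecomposition.exists_pow_le_comap_map`): then `e_𝔭` is a unit at `𝔭` and `e_𝔮I_𝔮 ⊆ (I_𝔭)_(𝔭)`,
so `J_𝔭 = (I_𝔭)_𝔭` EXACTLY.  With `CMOrderWeakEquivalenceSingularPrimes` (g26-#4: weak equivalence ⟺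
`𝔭`-equivalence at the primes `𝔭 ⊇ 𝔣`) this is Theorem 4.4's bijection `W(R) ≅ ∏_{𝔭 ⊇ 𝔣} W_𝔭(R)` in
components: injective by g26-#4, surjective here.

Conventions: `R_𝔭 = Localization.subalgebra.ofField K 𝔭.primeCompl _ ⊆ K`, `N_𝔭 = span R_𝔭 ↑N`
(`CMOrderLocallyPrincipal`); the `𝔭`-primary part `I_(𝔭) = (I.map (algebraMap R (Localization.AtPrime 𝔭))).comap _`
(`CMOrderPrimaryDecomposition`).

## Source, VERBATIM

S. Marseglia, *Local isomorphism classes of fractional ideals of orders in étale algebras*, J. Algebra 673 (2025)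
77–102 [Marseglia2025LocalIsomorphism] (arXiv:2311.18571, held `paper:arxiv-2311.18571`, chunk p0008, §4):
"Theorem 4.4. We have natural monoid isomorphisms `W_𝒮(R) ⟷ ∏_{𝔭 ∈ 𝒮₀} W(R + 𝔭^{n_𝔭}𝒪)` inducing a bijection
`W̄_𝒮(R) ⟷ ∏_{𝔭 ∈ 𝒮₀} W̄(R + 𝔭^{n_𝔭}𝒪)`.  Proof. By Proposition 3.4, we have that `W_𝒮(R) = W_{𝒮₀}(R)`. …
Consider the natural injective map of monoids `ψ : W_{𝒮₀}(R) → ∏_{𝔭 ∈ 𝒮₀} W_𝔭(R)`. We now prove that `ψ` is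
surjective. Denote by `𝔭₁, …, 𝔭ₙ` the maximal ideals in `𝒮₀`. Consider a vector of classes
`([I₁]_{𝔭₁}, …, [Iₙ]_{𝔭ₙ})` in the codomain of `ψ`. Without loss of generality, we can assume that the representatives
`I_i` are contained in `R`. For each `i`, let `k_i` be non-negative integers such that `𝔭_i^{k_i}R_{𝔭_i} ⊆ (I_i)_{𝔭_i}`,
which exist since `R_{𝔭_i}` is Noetherian. Put `J = Σ_{i=1}^n ((I_i + 𝔭_i^{k_i}) ∏_{j ≠ i} 𝔭_j^{k_j})` (4.1)."
(and chunk p0009: "This means that `[J]_{𝒮₀}` is a preimage of `([I₁]_{𝔭₁}, …, [Iₙ]_{𝔭ₙ})`, and hence that `ψ` is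
also surjective.")  The multipliers used below (`e_i ≡ 1 mod 𝔭_i^{k_i+1}`, `≡ 0 mod 𝔭_j^{k_j+1}`) replace the
products `∏_{j≠i} 𝔭_j^{k_j}` of (4.1); the conclusion `J_{𝔭_i} = (I_i)_{𝔭_i}` is the same.

## What is formalised

* §1 (one-dimensional noetherian domain) `NumberRing.isCoprime_pow_of_ne`, `span_coe_le_of_le`,
  `span_coe_span_singleton_mul_eq_of_not_mem` (`(eI)_𝔭 = I_𝔭` for `e ∉ 𝔭`), and
  **`NumberRing.exists_ideal_forall_span_coe_eq`**: integral ideals `I_𝔭 ≠ 0` (`𝔭 ∈ F`) are the local components at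
  `F` of ONE nonzero ideal `J`.
* §2 **`NumberRing.exists_ne_zero_forall_span_coe_eq_of_ne_zero`**: the same for nonzero FRACTIONAL ideals (common
  denominator).
* §3 (`𝔯 = endOrder ρ`) **`EndOrder.exists_ne_zero_forall_span_coe_eq`** and the surjectivity of
  `ψ : W(𝔯) → ∏_{𝔭 ⊇ 𝔣} W_𝔭(𝔯)` in components, **`EndOrder.exists_forall_conductorIdeal_le_span_coe_eq`**: every
  family of `𝔭`-local data at the singular primes is realised by one fractional ideal, `𝔭`-equivalent (indeed with
  EQUAL local component) to the prescribed ideal at each `𝔭 ⊇ 𝔣` (injectivity of `ψ` is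
  `CMOrderWeakEquivalenceSingularPrimes.one_mem_div_mul_div_iff_forall_conductorIdeal_le`).
-/

open scoped nonZeroDivisors NumberField
open Module FractionalIdeal NumberField

namespace Literature.NumberTheory.ComplexMultiplication

namespace NumberRing

/-! ## §1 Integral ideals with prescribed local components at finitely many maximal ideals -/

section Integral

variable {R : Type*} [CommRing R] [IsDomain R] {K : Type*} [Field K] [Algebra R K] [IsFractionRing R K]

omit [IsDomain R] in
/-- Powers of distinct maximal ideals are coprime (plumbing for the Chinese remainder step «`∏_{j≠i} 𝔭_j^{k_j}`»).
[cite: Marseglia2025LocalIsomorphism, §4, proof of Thm. 4.4 (eq. (4.1)), p. 8] -/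
theorem isCoprime_pow_of_ne {𝔭 𝔮 : MaximalSpectrum R} (h : 𝔭 ≠ 𝔮) (m n : ℕ) :
    IsCoprime (𝔭.asIdeal ^ m) (𝔮.asIdeal ^ n) :=
  (Ideal.isCoprime_iff_sup_eq.2 (𝔭.isMaximal.coprime_of_ne 𝔮.isMaximal fun e ↦ h (MaximalSpectrum.ext e))).pow

omit [IsDomain R] [IsFractionRing R K] in
/-- `A·x · A·y = A·xy` (plumbing). [cite: Marseglia2025LocalIsomorphism, §2 («`(IJ)_𝔭 = I_𝔭J_𝔭`»), p. 5] -/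
theorem span_singleton_mul_span_singleton' (A : Subalgebra R K) (x y : K) :
    Submodule.span A {x} * Submodule.span A {y} = Submodule.span A {x * y} := by
  rw [Submodule.span_mul_span, Set.singleton_mul_singleton]

omit [IsDomain R] in
/-- Monotonicity of local components: `I ⊆ J ⟹ I_𝔭 ⊆ J_𝔭` (plumbing). [cite: Marseglia2025LocalIsomorphism, §2
(«`I_𝔭 = I ⊗_R R_𝔭`»), p. 5] -/
theorem span_coe_le_of_le (A : Subalgebra R K) {I J : Ideal R} (h : I ≤ J) :
    Submodule.span A ((I : FractionalIdeal R⁰ K) : Set K) ≤ Submodule.span A ((J : FractionalIdeal R⁰ K) : Set K) :=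
  Submodule.span_mono (coeIdeal_le_coeIdeal K |>.2 h)

/-- **`(eI)_𝔭 = I_𝔭` for a multiplier `e ∈ R ∖ 𝔭`** (a local unit). [cite: Marseglia2025LocalIsomorphism, §4, proof
of Thm. 4.4 («`J_{𝔭_i} = (I_i)_{𝔭_i}`»-type computation), pp. 8–9] -/
theorem span_coe_span_singleton_mul_eq_of_not_mem {e : R} {𝔭 : Ideal R} [𝔭.IsPrime] (he : e ∉ 𝔭) (I : Ideal R) :
    Submodule.span (Localization.subalgebra.ofField K 𝔭.primeCompl 𝔭.primeCompl_le_nonZeroDivisors)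
        (((Ideal.span {e} * I : Ideal R) : FractionalIdeal R⁰ K) : Set K) =
      Submodule.span (Localization.subalgebra.ofField K 𝔭.primeCompl 𝔭.primeCompl_le_nonZeroDivisors)
        ((I : FractionalIdeal R⁰ K) : Set K) := by
  rw [coeIdeal_mul, span_coe_mul, span_coe_coeIdeal_span_singleton, span_singleton_algebraMap_eq_span_one he,
    ← Submodule.one_eq_span, one_mul]

/-- **PRESCRIBED LOCAL COMPONENTS (the surjectivity step of THEOREM 4.4): for a finite set `F` of maximal ideals and
nonzero ideals `I_𝔭` (`𝔭 ∈ F`) of a one-dimensional noetherian domain there is a nonzero ideal `J` with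
`J_𝔭 = (I_𝔭)_𝔭` for every `𝔭 ∈ F`** — `J = Σ_{𝔭∈F} e_𝔭I_𝔭` with `e_𝔭 ≡ 1 (mod 𝔭^{n_𝔭+1})`, `e_𝔭 ∈ 𝔮^{n_𝔮+1}`
(`𝔮 ∈ F ∖ {𝔭}`), `𝔮^{n_𝔮} ⊆ (I_𝔮)_(𝔮)`: at `𝔭`, `e_𝔭` is a unit and `e_𝔮I_𝔮 ⊆ (I_𝔭)_(𝔭)`, whose local component
is `(I_𝔭)_𝔭` («Put `J = Σᵢ ((I_i + 𝔭_i^{k_i}) ∏_{j≠i} 𝔭_j^{k_j})` … `[J]_{𝒮₀}` is a preimage of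
`([I₁]_{𝔭₁}, …, [Iₙ]_{𝔭ₙ})`»). [cite: Marseglia2025LocalIsomorphism, §4 Thm. 4.4 (proof, eq. (4.1)), pp. 8–9]
[cite: Stevenhagen2008NumberRings, §5 Lemma 5.1 / Thm. 5.2 («the `𝔭`-primary part `I_(𝔭)` … contains some power of
`𝔭`»), p. 218] -/
theorem exists_ideal_forall_span_coe_eq [IsNoetherianRing R] [Ring.DimensionLEOne R]
    (F : Finset (MaximalSpectrum R)) (I : MaximalSpectrum R → Ideal R) (hI : ∀ 𝔭 ∈ F, I 𝔭 ≠ ⊥) :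
    ∃ J : Ideal R, J ≠ ⊥ ∧ ∀ 𝔭 ∈ F,
      Submodule.span (Localization.subalgebra.ofField K 𝔭.asIdeal.primeCompl
          𝔭.asIdeal.primeCompl_le_nonZeroDivisors) ((J : FractionalIdeal R⁰ K) : Set K) =
        Submodule.span (Localization.subalgebra.ofField K 𝔭.asIdeal.primeCompl
          𝔭.asIdeal.primeCompl_le_nonZeroDivisors) ((I 𝔭 : FractionalIdeal R⁰ K) : Set K) := by
  classical
  rcases F.eq_empty_or_nonempty with rfl | hF
  · exact ⟨⊤, top_ne_bot, fun 𝔭 h ↦ absurd h (Finset.notMem_empty 𝔭)⟩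
  -- exponents: `𝔭^{n_𝔭} ⊆ (I_𝔭)_(𝔭)`
  have hpow : ∀ 𝔭 : MaximalSpectrum R, 𝔭 ∈ F → ∃ n : ℕ, 𝔭.asIdeal ^ n ≤
      ((I 𝔭).map (algebraMap R (Localization.AtPrime 𝔭.asIdeal))).comap
        (algebraMap R (Localization.AtPrime 𝔭.asIdeal)) := fun 𝔭 h𝔭 ↦ by
    haveI := 𝔭.isMaximal
    exact exists_pow_le_comap_map (hI 𝔭 h𝔭) 𝔭.asIdeal
  choose! n hn using hpow
  -- CRT multipliers
  have hcop : Pairwise (Function.onFun IsCoprime fun 𝔭 : F ↦ (𝔭 : MaximalSpectrum R).asIdeal ^ (n 𝔭 + 1)) :=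
    fun 𝔭 𝔮 hne ↦ isCoprime_pow_of_ne (fun e ↦ hne (Subtype.ext e)) _ _
  have hcrt : ∀ 𝔭 : F, ∃ e : R, e - 1 ∈ (𝔭 : MaximalSpectrum R).asIdeal ^ (n 𝔭 + 1) ∧
      ∀ 𝔮 : F, 𝔮 ≠ 𝔭 → e ∈ (𝔮 : MaximalSpectrum R).asIdeal ^ (n 𝔮 + 1) := fun 𝔭 ↦ by
    obtain ⟨e, he⟩ := Ideal.exists_forall_sub_mem_ideal hcop fun 𝔮 ↦ if 𝔮 = 𝔭 then (1 : R) else 0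
    exact ⟨e, by simpa using he 𝔭, fun 𝔮 hne ↦ by simpa [hne] using he 𝔮⟩
  choose e he1 he0 using hcrt
  -- `e_𝔭 ∉ 𝔭`
  have he_nmem : ∀ 𝔭 : F, e 𝔭 ∉ (𝔭 : MaximalSpectrum R).asIdeal := fun 𝔭 h ↦
    (𝔭 : MaximalSpectrum R).isMaximal.ne_top ((Ideal.eq_top_iff_one _).2 (by
      have h1 : e 𝔭 - 1 ∈ (𝔭 : MaximalSpectrum R).asIdeal := Ideal.pow_le_self (Nat.succ_ne_zero _) (he1 𝔭)
      have := Ideal.sub_mem _ h h1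
      rwa [sub_sub_cancel] at this))
  -- the ideal `J = Σ e_𝔭 I_𝔭`
  set J : Ideal R := ∑ 𝔭 : F, Ideal.span {e 𝔭} * I 𝔭 with hJ
  obtain ⟨𝔭₀, h𝔭₀⟩ := hF
  refine ⟨J, fun h0 ↦ ?_, fun 𝔭 h𝔭 ↦ ?_⟩
  · -- `J ⊇ e_{𝔭₀} I_{𝔭₀} ≠ 0`
    have hle : Ideal.span {e ⟨𝔭₀, h𝔭₀⟩} * I 𝔭₀ ≤ J := by
      rw [hJ, ← Finset.add_sum_erase Finset.univ _ (Finset.mem_univ (⟨𝔭₀, h𝔭₀⟩ : F))]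
      exact le_sup_left
    rw [h0, le_bot_iff, Ideal.mul_eq_bot, Ideal.span_singleton_eq_bot] at hle
    rcases hle with h | h
    · exact he_nmem ⟨𝔭₀, h𝔭₀⟩ (h ▸ Ideal.zero_mem _)
    · exact hI 𝔭₀ h𝔭₀ h
  · haveI := 𝔭.isMaximal
    set A := Localization.subalgebra.ofField K 𝔭.asIdeal.primeCompl 𝔭.asIdeal.primeCompl_le_nonZeroDivisors with hA
    have hterm : ∀ 𝔮 : F, Ideal.span {e 𝔮} * I 𝔮 ≤ J := fun 𝔮 ↦ by
      rw [hJ, ← Finset.add_sum_erase Finset.univ _ (Finset.mem_univ 𝔮)]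
      exact le_sup_left
    apply le_antisymm
    · -- `J ⊆ (I_𝔭)_(𝔭)` globally, and `((I_𝔭)_(𝔭))_𝔭 = (I_𝔭)_𝔭`
      have hJle : J ≤ ((I 𝔭).map (algebraMap R (Localization.AtPrime 𝔭.asIdeal))).comap
          (algebraMap R (Localization.AtPrime 𝔭.asIdeal)) := by
        rw [hJ]
        refine Finset.sum_induction _ (fun X : Ideal R ↦ X ≤ ((I 𝔭).map
            (algebraMap R (Localization.AtPrime 𝔭.asIdeal))).comap (algebraMap R (Localization.AtPrime 𝔭.asIdeal)))
          (fun a b ha hb ↦ sup_le ha hb) bot_le fun 𝔮 _ ↦ ?_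
        by_cases hq : 𝔮 = ⟨𝔭, h𝔭⟩
        · subst hq
          exact Ideal.mul_le_left.trans (le_comap_map _ _)
        · exact Ideal.mul_le_right.trans (((Ideal.span_singleton_le_iff_mem _).2
            (he0 𝔮 ⟨𝔭, h𝔭⟩ (Ne.symm hq))).trans ((Ideal.pow_le_pow_right (Nat.le_succ _)).trans (hn 𝔭 h𝔭)))
      calc Submodule.span A ((J : FractionalIdeal R⁰ K) : Set K)
          ≤ Submodule.span A ((((I 𝔭).map (algebraMap R (Localization.AtPrime 𝔭.asIdeal))).comap
              (algebraMap R (Localization.AtPrime 𝔭.asIdeal)) : FractionalIdeal R⁰ K) : Set K) :=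
            span_coe_le_of_le A hJle
        _ = Submodule.span A ((I 𝔭 : FractionalIdeal R⁰ K) : Set K) := span_coe_comap_map_eq (I 𝔭) 𝔭.asIdeal
    · -- `(I_𝔭)_𝔭 = (e_𝔭I_𝔭)_𝔭 ⊆ J_𝔭`
      rw [← span_coe_span_singleton_mul_eq_of_not_mem (K := K) (he_nmem ⟨𝔭, h𝔭⟩) (I 𝔭)]
      exact span_coe_le_of_le A (hterm ⟨𝔭, h𝔭⟩)

end Integral

/-! ## §2 Fractional ideals with prescribed local components (common denominator) -/

section Fractional

variable {R : Type*} [CommRing R] [IsDomain R] {K : Type*} [Field K] [Algebra R K] [IsFractionRing R K]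

/-- **The same for FRACTIONAL ideals: nonzero `N_𝔭` (`𝔭 ∈ F`) are the local components at `F` of one nonzero
fractional ideal `J`** («Without loss of generality, we can assume that the representatives `I_i` are contained in
`R`»: clear a common denominator `a = ∏ a_𝔭`, realise the integral ideals `(a/a_𝔭)·𝔞_𝔭`, divide by `a`).
[cite: Marseglia2025LocalIsomorphism, §4 Thm. 4.4 (proof), pp. 8–9] -/
theorem exists_ne_zero_forall_span_coe_eq_of_ne_zero [IsNoetherianRing R] [Ring.DimensionLEOne R]
    (F : Finset (MaximalSpectrum R)) (N : MaximalSpectrum R → FractionalIdeal R⁰ K) (hN : ∀ 𝔭 ∈ F, N 𝔭 ≠ 0) :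
    ∃ J : FractionalIdeal R⁰ K, J ≠ 0 ∧ ∀ 𝔭 ∈ F,
      Submodule.span (Localization.subalgebra.ofField K 𝔭.asIdeal.primeCompl
          𝔭.asIdeal.primeCompl_le_nonZeroDivisors) (J : Set K) =
        Submodule.span (Localization.subalgebra.ofField K 𝔭.asIdeal.primeCompl
          𝔭.asIdeal.primeCompl_le_nonZeroDivisors) (N 𝔭 : Set K) := by
  classical
  -- `N_𝔭 = a_𝔭⁻¹ 𝔞_𝔭`
  have hrep : ∀ 𝔭 : MaximalSpectrum R, ∃ a : R, ∃ 𝔞 : Ideal R, a ≠ 0 ∧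
      N 𝔭 = spanSingleton R⁰ (algebraMap R K a)⁻¹ * 𝔞 := fun 𝔭 ↦ exists_eq_spanSingleton_mul (N 𝔭)
  choose a 𝔞 ha0 hNa using hrep
  -- common denominator `d = ∏_{𝔭 ∈ F} a_𝔭`, integral ideals `b_𝔭 𝔞_𝔭` with `b_𝔭 = ∏_{𝔮 ≠ 𝔭} a_𝔮`
  set d : R := ∏ 𝔭 ∈ F, a 𝔭 with hd
  have hd0 : d ≠ 0 := Finset.prod_ne_zero_iff.2 fun 𝔭 _ ↦ ha0 𝔭
  have hd0' : algebraMap R K d ≠ 0 := fun h ↦ hd0 (IsFractionRing.injective R K (h.trans (map_zero _).symm))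
  have h𝔞0 : ∀ 𝔭 ∈ F, Ideal.span {∏ 𝔮 ∈ F.erase 𝔭, a 𝔮} * 𝔞 𝔭 ≠ ⊥ := fun 𝔭 h𝔭 h ↦ by
    rw [Ideal.mul_eq_bot, Ideal.span_singleton_eq_bot] at h
    rcases h with h | h
    · exact Finset.prod_ne_zero_iff.2 (fun 𝔮 _ ↦ ha0 𝔮) h
    · exact hN 𝔭 h𝔭 (by rw [hNa 𝔭, h, coeIdeal_bot, mul_zero])
  obtain ⟨J₀, hJ₀, hJ⟩ := exists_ideal_forall_span_coe_eq (K := K) F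
    (fun 𝔭 ↦ Ideal.span {∏ 𝔮 ∈ F.erase 𝔭, a 𝔮} * 𝔞 𝔭) h𝔞0
  refine ⟨spanSingleton R⁰ (algebraMap R K d)⁻¹ * J₀, fun h0 ↦ hJ₀ ?_, fun 𝔭 h𝔭 ↦ ?_⟩
  · have hJ₀eq : ((J₀ : Ideal R) : FractionalIdeal R⁰ K) =
        spanSingleton R⁰ (algebraMap R K d) * (spanSingleton R⁰ (algebraMap R K d)⁻¹ * J₀) := by
      rw [← mul_assoc, spanSingleton_mul_spanSingleton, mul_inv_cancel₀ hd0', spanSingleton_one, one_mul]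
    rw [h0, mul_zero] at hJ₀eq
    exact coeIdeal_eq_zero.1 hJ₀eq
  · haveI := 𝔭.isMaximal.isPrime
    rw [span_coe_mul, span_coe_spanSingleton, hJ 𝔭 h𝔭, hNa 𝔭, span_coe_mul, span_coe_spanSingleton, coeIdeal_mul,
      span_coe_mul, span_coe_coeIdeal_span_singleton, ← mul_assoc, span_singleton_mul_span_singleton', hd,
      ← Finset.mul_prod_erase F a h𝔭, map_mul, mul_inv, mul_assoc _⁻¹ _⁻¹, inv_mul_cancel₀
        (fun h ↦ Finset.prod_ne_zero_iff.2 (fun 𝔮 _ ↦ ha0 𝔮) (IsFractionRing.injective R K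
          (h.trans (map_zero _).symm))), mul_one]

end Fractional

end NumberRing

/-! ## §3 The order `𝔯 = endOrder ρ`: `ψ : W(𝔯) → ∏_{𝔭 ⊇ 𝔣} W_𝔭(𝔯)` is onto -/

namespace EndOrder

variable {K : Type} [Field K] [NumberField K]
variable {ι : Type} [Fintype ι] [DecidableEq ι] [Nonempty ι] {ρ : K →ₐ[ℚ] Matrix ι ι ℚ}
variable [IsFractionRing (endOrder ρ) K]

/-- **Prescribed local components for the order `𝔯 = endOrder ρ`** (any number field, any degree): nonzero
fractional ideals `N_𝔭` (`𝔭 ∈ F` finite) are the local components at `F` of one nonzero fractional ideal.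
[cite: Marseglia2025LocalIsomorphism, §4 Thm. 4.4 (proof), pp. 8–9] -/
theorem exists_ne_zero_forall_span_coe_eq (F : Finset (MaximalSpectrum (endOrder ρ)))
    (N : MaximalSpectrum (endOrder ρ) → FractionalIdeal (endOrder ρ)⁰ K) (hN : ∀ 𝔭 ∈ F, N 𝔭 ≠ 0) :
    ∃ J : FractionalIdeal (endOrder ρ)⁰ K, J ≠ 0 ∧ ∀ 𝔭 ∈ F,
      Submodule.span (Localization.subalgebra.ofField K 𝔭.asIdeal.primeCompl
          𝔭.asIdeal.primeCompl_le_nonZeroDivisors) (J : Set K) =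
        Submodule.span (Localization.subalgebra.ofField K 𝔭.asIdeal.primeCompl
          𝔭.asIdeal.primeCompl_le_nonZeroDivisors) (N 𝔭 : Set K) :=
  haveI := CMTypeLattice.isNoetherianRing_endOrder ρ
  haveI := CMTypeLattice.dimensionLEOne_endOrder ρ
  NumberRing.exists_ne_zero_forall_span_coe_eq_of_ne_zero F N hN

/-- **THEOREM 4.4, the surjectivity of `ψ : W(R) → ∏_{𝔭 ∈ 𝒮₀} W_𝔭(R)`** for the order `𝔯 = endOrder ρ`: for every
family of nonzero fractional ideals `(N_𝔭)` indexed by the SINGULAR maximal ideals `𝔭 ⊇ 𝔣` (collected in any finite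
`F`), there is ONE fractional ideal `J` which is `𝔭`-equivalent to `N_𝔭` — indeed `J_𝔭 = 1·(N_𝔭)_𝔭` — at every
`𝔭 ⊇ 𝔣` («`[J]_{𝒮₀}` is a preimage of `([I₁]_{𝔭₁}, …, [Iₙ]_{𝔭ₙ})`, and hence `ψ` is also surjective»; `ψ` is
injective by `CMOrderWeakEquivalenceSingularPrimes.one_mem_div_mul_div_iff_forall_conductorIdeal_le`).
[cite: Marseglia2025LocalIsomorphism, §4 Thm. 4.4, pp. 8–9] -/
theorem exists_forall_conductorIdeal_le_span_coe_eq (F : Finset (MaximalSpectrum (endOrder ρ)))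
    (hF : ∀ 𝔭 : MaximalSpectrum (endOrder ρ), conductorIdeal ρ ≤ 𝔭.asIdeal → 𝔭 ∈ F)
    (N : MaximalSpectrum (endOrder ρ) → FractionalIdeal (endOrder ρ)⁰ K) (hN : ∀ 𝔭 ∈ F, N 𝔭 ≠ 0) :
    ∃ J : FractionalIdeal (endOrder ρ)⁰ K, J ≠ 0 ∧ ∀ 𝔭 : MaximalSpectrum (endOrder ρ),
      conductorIdeal ρ ≤ 𝔭.asIdeal → ∃ x : K, x ≠ 0 ∧
        Submodule.span (Localization.subalgebra.ofField K 𝔭.asIdeal.primeCompl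
            𝔭.asIdeal.primeCompl_le_nonZeroDivisors) (J : Set K) =
          Submodule.span (Localization.subalgebra.ofField K 𝔭.asIdeal.primeCompl
              𝔭.asIdeal.primeCompl_le_nonZeroDivisors) {x} *
            Submodule.span (Localization.subalgebra.ofField K 𝔭.asIdeal.primeCompl
              𝔭.asIdeal.primeCompl_le_nonZeroDivisors) (N 𝔭 : Set K) := by
  obtain ⟨J, hJ0, hJ⟩ := exists_ne_zero_forall_span_coe_eq F N hN
  refine ⟨J, hJ0, fun 𝔭 hle ↦ ⟨1, one_ne_zero, ?_⟩⟩
  rw [hJ 𝔭 (hF 𝔭 hle), ← Submodule.one_eq_span, one_mul]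

end EndOrder

end Literature.NumberTheory.ComplexMultiplication
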